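import Literature.AlgebraicGeometry.ProjectiveSpace.EdgeIdealNormallyTorsionFree
import Literature.AlgebraicGeometry.ProjectiveSpace.MonomialIdealAssociatedPrimesOfPowers
import HarnessLib

/-!
# Associated primes of the graded pieces `I(G)^s/I(G)^{s+1}` of an edge ideal
# (Martínez-Bernal–Morey–Villarreal Corollary 2.19; Carlini–Hà–Harbourne–Van Tuyl Lemma 2.5 with
# Theorem 2.18 (i) and Remark 2.19)

Topic `Literature/AlgebraicGeometry/ProjectiveSpace`, namespace
`Literature.AlgebraicGeometry.ProjectiveSpace`. Lane `lit-hodgefound`, seat `lit-hodgefound-p32`,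
row gen33-#4. Theorems only (no `def`, no named fact). Assembles gen32-#4
(`MonomialIdealAssociatedPrimesOfPowers`: Carlini Lemma 2.5, `Ass_R(I^s/I^{s+1}) = Ass_R(R/I^{s+1})`
for a non-zero monomial ideal), gen33-#2 (`EdgeIdealPersistence`: MMV Theorem 2.15), gen32-#1
(`Ass(S/I(G)^m)` for bipartite `G`) and gen33-#3 (embedded primes for non-bipartite `G`).

## The sources, as printed

Martínez-Bernal–Morey–Villarreal, §2: "It is also of interest to note that for square-free monomial
ideals, knowing that the sets `Ass(R/I^k)` form an ascending chain immediately implies that the sets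
`Ass(I^{k−1}/I^k)` form an ascending chain as well. Thus we get the following corollary of Theorem
2.15. **Corollary 2.19** Let `I = I(G)` be the edge ideal of a graph `G`, then `Ass(I^{k−1}/I^k)`
form an ascending chain for `k ≥ 1`."  Carlini–Hà–Harbourne–Van Tuyl, **Lemma 2.5** "For any
monomial ideal `I ⊆ R`, `Ass_R(I^s/I^{s+1}) = Ass_R(R/I^{s+1})` for all `s ≥ 0`." **Theorem 2.18**
"(i) If `G` is a bipartite graph, then `astab(I(G)) = 1`." **Remark 2.19** "… `I = I(G)` is normally
torsion free if `G` is bipartite … `ass(I^m) = ass(I^{(m)}) = ass(I)` for all `m ≥ 1`."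

## What is here (`S = k[x_σ]`, the graded piece `I^s/I^{s+1}` realised as
`Submodule.map (I^{s+1}).mkQ (I^s) ⊆ S ⧸ I^{s+1}` as in gen32-#2/#4)

* § 1 `I(G) ≠ 0` when `G` has an edge, and `Ass_S(I(G)^s/I(G)^{s+1}) = Ass_S(S/I(G)^{s+1})`
  (`associatedPrimes_gradedPiece_edgeIdeal_eq`, Lemma 2.5 specialised).
* § 2 **Corollary 2.19: `Ass_S(I(G)^s/I(G)^{s+1}) ⊆ Ass_S(I(G)^{s'}/I(G)^{s'+1})` for `s ≤ s'`**
  (`associatedPrimes_gradedPiece_edgeIdeal_mono`), for every graph with at least one edge (for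
  `E(G) = ∅` the chain `Ass(S/0) = {0} ⊄ ∅ = Ass(0/0)` fails).
* § 3 bipartite `G`: `Ass_S(I(G)^s/I(G)^{s+1}) = {P_W : W a minimal vertex cover}` for every `s`
  (`isAssociatedPrime_gradedPiece_edgeIdeal_iff_of_colorable_two`); non-bipartite `G`: some graded
  piece, and every later one, has an embedded associated prime
  (`exists_embedded_isAssociatedPrime_gradedPiece_edgeIdeal`).

## References

* [MartinezBernalMoreyVillarreal2012] J. Martínez-Bernal, S. Morey, R. H. Villarreal, *Associated
  primes of powers of edge ideals*, Collect. Math. 63 (2012) 361–374, Corollary 2.19, Theorem 2.15.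
* [CarliniEtAl2020] E. Carlini, H. T. Hà, B. Harbourne, A. Van Tuyl, *Ideals of Powers and Powers of
  Ideals*, LN UMI 27, Springer 2020, Lemma 2.5, Theorem 2.18 (i), Remark 2.19.
* [Villarreal2015MonomialAlgebras] R. H. Villarreal, *Monomial Algebras*, 2nd ed., CRC Press 2015,
  Theorem 7.7.14, Theorem 14.3.6, Proposition 14.3.39.
-/

noncomputable section

open Finset MvPolynomial SimpleGraph

universe u

namespace Literature.AlgebraicGeometry.ProjectiveSpace

variable {σ : Type*} [Fintype σ] [DecidableEq σ]
variable {k : Type u} [Field k]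
variable (G : SimpleGraph σ)

/-! ### § 1 The graded pieces of an edge ideal -/

omit [Fintype σ] [DecidableEq σ] in
/-- The edge ideal of a graph with an edge is non-zero. [cite: MartinezBernalMoreyVillarreal2012, §2
("`I ≠ (0)` is an ideal"); CarliniEtAl2020, Lemma 2.5] -/
theorem edgeIdeal_ne_bot (hE : ∃ p q, G.Adj p q) :
    Ideal.span {f : MvPolynomial σ k | ∃ u v : σ, G.Adj u v ∧ f = X u * X v} ≠ ⊥ := by
  obtain ⟨p, q, hpq⟩ := hE
  intro h
  rw [Ideal.span_eq_bot] at h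
  have hX : (X p * X q : MvPolynomial σ k) = 0 := h _ ⟨p, q, hpq, rfl⟩
  rw [X, X, monomial_mul, monomial_eq_zero] at hX
  exact one_ne_zero ((mul_one (1 : k)).symm.trans hX)

omit [DecidableEq σ] in
/-- **Lemma 2.5 for edge ideals: `Ass_S(I(G)^s/I(G)^{s+1}) = Ass_S(S/I(G)^{s+1})`** for every graph
with at least one edge and every `s`. [cite: CarliniEtAl2020, Lemma 2.5;
MartinezBernalMoreyVillarreal2012, Corollary 2.19 (proof)] -/
theorem associatedPrimes_gradedPiece_edgeIdeal_eq (hE : ∃ p q, G.Adj p q) (s : ℕ) :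
    associatedPrimes (MvPolynomial σ k) ↥(Submodule.map (Submodule.mkQ
        ((Ideal.span {f : MvPolynomial σ k | ∃ u v : σ, G.Adj u v ∧ f = X u * X v}) ^ (s + 1)))
        ((Ideal.span {f : MvPolynomial σ k | ∃ u v : σ, G.Adj u v ∧ f = X u * X v}) ^ s)) =
      associatedPrimes (MvPolynomial σ k) (MvPolynomial σ k ⧸
        (Ideal.span {f : MvPolynomial σ k | ∃ u v : σ, G.Adj u v ∧ f = X u * X v}) ^ (s + 1)) := by
  refine associatedPrimes_gradedPiece_eq_of_monomial (fun g hg c hc => ?_) (edgeIdeal_ne_bot G hE) s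
  have h1 := monomial_mem_edgeIdeal_pow_of_mem_support G 1 g (by rwa [pow_one]) c hc
  rwa [pow_one] at h1

/-! ### § 2 Corollary 2.19: the graded pieces' associated primes form an ascending chain -/

/-- **Corollary 2.19 (Martínez-Bernal–Morey–Villarreal): for the edge ideal `I = I(G)` of a graph
with at least one edge, the sets `Ass(I^{k−1}/I^k)`, `k ≥ 1`, form an ascending chain** — here as
`Ass_S(I^s/I^{s+1}) ⊆ Ass_S(I^{s'}/I^{s'+1})` for `s ≤ s'` (by Lemma 2.5 both sides are
`Ass_S(S/I^{s+1}) ⊆ Ass_S(S/I^{s'+1})`, Theorem 2.15).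
[cite: MartinezBernalMoreyVillarreal2012, Corollary 2.19 and Theorem 2.15; CarliniEtAl2020, Lemma 2.5
and Theorem 2.29] -/
theorem associatedPrimes_gradedPiece_edgeIdeal_mono (hE : ∃ p q, G.Adj p q) {s s' : ℕ} (hss' : s ≤ s') :
    associatedPrimes (MvPolynomial σ k) ↥(Submodule.map (Submodule.mkQ
        ((Ideal.span {f : MvPolynomial σ k | ∃ u v : σ, G.Adj u v ∧ f = X u * X v}) ^ (s + 1)))
        ((Ideal.span {f : MvPolynomial σ k | ∃ u v : σ, G.Adj u v ∧ f = X u * X v}) ^ s)) ⊆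
      associatedPrimes (MvPolynomial σ k) ↥(Submodule.map (Submodule.mkQ
        ((Ideal.span {f : MvPolynomial σ k | ∃ u v : σ, G.Adj u v ∧ f = X u * X v}) ^ (s' + 1)))
        ((Ideal.span {f : MvPolynomial σ k | ∃ u v : σ, G.Adj u v ∧ f = X u * X v}) ^ s')) := by
  rw [associatedPrimes_gradedPiece_edgeIdeal_eq G hE s, associatedPrimes_gradedPiece_edgeIdeal_eq G hE s']
  exact associatedPrimes_edgeIdeal_pow_mono G (by omega)

/-! ### § 3 Bipartite and non-bipartite graphs -/

/-- **Bipartite `G`: `P ∈ Ass_S(I(G)^s/I(G)^{s+1})` iff `P = (x_i : i ∈ W)` for a minimal vertex cover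
`W`**, for every `s` (`astab(I(G)) = 1` read on the graded pieces).
[cite: CarliniEtAl2020, Theorem 2.18 (i), Remark 2.19 and Lemma 2.5;
MartinezBernalMoreyVillarreal2012, Corollary 2.19] -/
theorem isAssociatedPrime_gradedPiece_edgeIdeal_iff_of_colorable_two (hG : G.Colorable 2)
    (hE : ∃ p q, G.Adj p q) (s : ℕ) (Q : Ideal (MvPolynomial σ k)) :
    Q ∈ associatedPrimes (MvPolynomial σ k) ↥(Submodule.map (Submodule.mkQ
        ((Ideal.span {f : MvPolynomial σ k | ∃ u v : σ, G.Adj u v ∧ f = X u * X v}) ^ (s + 1)))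
        ((Ideal.span {f : MvPolynomial σ k | ∃ u v : σ, G.Adj u v ∧ f = X u * X v}) ^ s)) ↔
      ∃ W : Finset σ, Minimal (fun W : Finset σ => G.IsVertexCover ↑W) W ∧
        Q = Ideal.span ((X : σ → MvPolynomial σ k) '' (↑W : Set σ)) := by
  rw [associatedPrimes_gradedPiece_edgeIdeal_eq G hE s]
  exact isAssociatedPrime_edgeIdeal_pow_iff_of_colorable_two G hG (Nat.succ_ne_zero s) Q

omit [DecidableEq σ] in
/-- **Non-bipartite `G`: some graded piece `I(G)^s/I(G)^{s+1}`, and every later one, has an embedded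
associated prime** (strictly containing the prime of a minimal vertex cover).
[cite: Villarreal2015MonomialAlgebras, Theorem 14.3.6 and Proposition 14.3.39; CarliniEtAl2020,
Lemma 2.5 and Remark 2.19; MartinezBernalMoreyVillarreal2012, Corollary 2.19] -/
theorem exists_embedded_isAssociatedPrime_gradedPiece_edgeIdeal (hG : ¬ G.Colorable 2) :
    ∃ s₀ : ℕ, ∃ P : Ideal (MvPolynomial σ k),
      (∃ W : Finset σ, Minimal (fun W : Finset σ => G.IsVertexCover ↑W) W ∧
        Ideal.span ((X : σ → MvPolynomial σ k) '' (↑W : Set σ)) < P) ∧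
      ∀ s, s₀ ≤ s → P ∈ associatedPrimes (MvPolynomial σ k) ↥(Submodule.map (Submodule.mkQ
        ((Ideal.span {f : MvPolynomial σ k | ∃ u v : σ, G.Adj u v ∧ f = X u * X v}) ^ (s + 1)))
        ((Ideal.span {f : MvPolynomial σ k | ∃ u v : σ, G.Adj u v ∧ f = X u * X v}) ^ s)) := by
  classical
  -- a non-bipartite graph has an edge
  have hE : ∃ p q, G.Adj p q := by
    by_contra hE
    push Not at hE
    exact hG ⟨SimpleGraph.Coloring.mk (fun _ => (0 : Fin 2)) fun h => (hE _ _ h).elim⟩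
  obtain ⟨m, hm, P, hPW, hP⟩ := exists_embedded_isAssociatedPrime_edgeIdeal_pow (k := k) G hG
  refine ⟨m - 1, P, hPW, fun s hs => ?_⟩
  rw [associatedPrimes_gradedPiece_edgeIdeal_eq G hE s]
  exact hP (s + 1) (by omega)

end Literature.AlgebraicGeometry.ProjectiveSpace
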